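import Summits.AnomalousDissipation.AnomalousDissipation.Theorems.SolenoidalFractalHomogenisationLagrangianStepOneLevelDefsSectorial
import HarnessLib

/-!
# K1L `LagrangianRenormalisationStep(Design)` (K1L_D, stmt-AnomalousDissipation-27980), stub `stub_cellLawV0_IS` — the Kato sector under an
# ABSOLUTELY small perturbation (the algebra that turns the quasi-static sector gain `κ` plus a mixing residue into `κ'·τ + ε`)
# (helper; `--supports stmt-AnomalousDissipation-27980`)

Summits-side helper file of route `SolenoidalFractalHomogenisation` (prover seat `ad-k1l-cellLawV-w1` g2).  The quasi-static excess contracts the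
Kato sector (`OddGain.oddSectorial_excQS_contraction`: `OddSectorial S τ → OddSectorial (excQS W₀ M S) (κτ)`, source `ε = 0`), while the consumer
`SectorialOddChannelBoundOn Φν S⋆ λ₀ Λ κ ε τ₀` (p645711) is stated for the TRUE cell map `Φν = (quasi-static part) + (mixing residue R)` with a source
`ε` («the ν-uniform mixing residue in sector units»).  This file is the generic step in between:
* `abs_le_mul_sqrt_of_sq_le` — `A² ≤ t²·a·b`, `t, a, b ≥ 0` ⇒ `|A| ≤ t·√(a·b)`;
* **`OddSectorial.add_of_oddSmall`** — if `X` is in the sector `t ≥ 0` with `NearIso X lo hi` (`lo > 0`), and the perturbation `R` is ABSOLUTELY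
  small: `OddSmall R ε₁` (odd part) and `|symb R k p| ≤ ε₂|k|²|p|²` on transverse pairs with `0 ≤ ε₂ < lo` (even part), then
  `OddSectorial (X + R) ((t·lo + ε₁)/(lo − ε₂))` — i.e. gain `κ·lo/(lo − ε₂)` and source `ε₁/(lo − ε₂)` in the `κτ + ε` format;
* `nearIso_add_of_abs_le` — the even companion: `NearIso (X + R) (lo − ε₂) (hi + ε₂)`.
Everything PROVED, no definition, no named fact, no sorry.  Infrastructure for route-1's rung leaf F-D1.A0 (frontier FORMAL rung); NOT a proof of the
stub, of the crux, of Onsager's conjecture or of anomalous dissipation.  Prover seat `ad-k1l-cellLawV-w1` g2, 2026-08-28.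
-/

set_option linter.dupNamespace false

namespace Summit.AnomalousDissipation.AnomalousDissipation.Theorems.SolenoidalFractalHomogenisation.LagrangianStep

open Literature.Analysis Literature.Analysis.FluidPDE Literature.Analysis.FunctionSpaces
open Finset

noncomputable section

/-- `A² ≤ t²·(a·b)` with `t ≥ 0` gives `|A| ≤ t·√(a·b)`. [folklore] -/
theorem abs_le_mul_sqrt_of_sq_le {A t a b : ℝ} (ht : 0 ≤ t) (h : A ^ 2 ≤ t ^ 2 * (a * b)) :
    |A| ≤ t * Real.sqrt (a * b) := by
  have h1 : Real.sqrt (A ^ 2) ≤ Real.sqrt (t ^ 2 * (a * b)) := Real.sqrt_le_sqrt h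
  rw [Real.sqrt_sq_eq_abs, Real.sqrt_mul (sq_nonneg t), Real.sqrt_sq ht] at h1
  exact h1

/-- **THE KATO SECTOR UNDER AN ABSOLUTELY SMALL PERTURBATION.**  `X` in the sector `t ≥ 0` with `NearIso X lo hi`, `lo > 0`; `R` with
`OddSmall R ε₁` (`ε₁ ≥ 0`) and `|symb R k p| ≤ ε₂·|k|²|p|²` on transverse pairs, `0 ≤ ε₂ < lo`.  Then `X + R` is in the sector `(t·lo + ε₁)/(lo − ε₂)`:
the odd parts add (`|odd X| ≤ t√(σσ)`, `|odd R| ≤ ε₁|k|²|p||q| ≤ (ε₁/lo)√(σσ)`), and the even part shrinks at most by `(lo − ε₂)/lo`. [folklore] -/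
theorem OddSectorial.add_of_oddSmall {X R : T4} {t lo hi ε₁ ε₂ : ℝ} (ht : 0 ≤ t) (hlo : 0 < lo)
    (hX : OddSectorial X t) (hXn : Torus.NearIso X lo hi) (hR : Torus.OddSmall R ε₁) (hε₁ : 0 ≤ ε₁)
    (hRn : ∀ k p : Fin 3 → ℝ, ∑ i, p i * k i = 0 → |Torus.symb R k p| ≤ ε₂ * ((∑ a, k a ^ 2) * ∑ i, p i ^ 2)) (hε₂0 : 0 ≤ ε₂)
    (hε₂ : ε₂ < lo) :
    OddSectorial (X + R) ((t * lo + ε₁) / (lo - ε₂)) := by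
  intro k p q hp hq
  obtain ⟨hlp, _⟩ := hXn k p hp
  obtain ⟨hlq, _⟩ := hXn k q hq
  have hRp := (abs_le.1 (hRn k p hp)).1
  have hRq := (abs_le.1 (hRn k q hq)).1
  have hQp0 : 0 ≤ (∑ a, k a ^ 2) * ∑ i, p i ^ 2 := by positivity
  have hQq0 : 0 ≤ (∑ a, k a ^ 2) * ∑ i, q i ^ 2 := by positivity
  have hXp0 : 0 ≤ Torus.symb X k p := (mul_nonneg hlo.le hQp0).trans hlp
  have hXq0 : 0 ≤ Torus.symb X k q := (mul_nonneg hlo.le hQq0).trans hlq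
  have hd : 0 < lo - ε₂ := by linarith
  -- the perturbed even symbols dominate `(lo − ε₂)/lo` of the old ones
  have hYp : Torus.symb X k p ≤ lo / (lo - ε₂) * Torus.symb (X + R) k p := by
    rw [Torus.symb_add, div_mul_eq_mul_div, le_div_iff₀ hd]
    nlinarith [mul_nonneg hε₂0 (sub_nonneg.2 hlp)]
  have hYq : Torus.symb X k q ≤ lo / (lo - ε₂) * Torus.symb (X + R) k q := by
    rw [Torus.symb_add, div_mul_eq_mul_div, le_div_iff₀ hd]
    nlinarith [mul_nonneg hε₂0 (sub_nonneg.2 hlq)]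
  -- the two odd parts against `√(σ_p·σ_q)`
  have hA : |Torus.bsymb X k p q - Torus.bsymb X k q p| ≤ t * Real.sqrt (Torus.symb X k p * Torus.symb X k q) :=
    abs_le_mul_sqrt_of_sq_le ht (hX k p q hp hq)
  have hB0 : |Torus.bsymb R k p q - Torus.bsymb R k q p| ≤
      ε₁ * Real.sqrt (((∑ a, k a ^ 2) * ∑ i, p i ^ 2) * ((∑ a, k a ^ 2) * ∑ i, q i ^ 2)) := by
    refine abs_le_mul_sqrt_of_sq_le hε₁ ?_
    calc _ ≤ ε₁ ^ 2 * ((∑ a, k a ^ 2) ^ 2 * ((∑ i, p i ^ 2) * (∑ i, q i ^ 2))) := hR k p q hp hq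
      _ = ε₁ ^ 2 * (((∑ a, k a ^ 2) * ∑ i, p i ^ 2) * ((∑ a, k a ^ 2) * ∑ i, q i ^ 2)) := by ring
  have hkey : lo * Real.sqrt (((∑ a, k a ^ 2) * ∑ i, p i ^ 2) * ((∑ a, k a ^ 2) * ∑ i, q i ^ 2)) ≤
      Real.sqrt (Torus.symb X k p * Torus.symb X k q) := by
    rw [← Real.sqrt_sq hlo.le, ← Real.sqrt_mul (sq_nonneg lo)]
    refine Real.sqrt_le_sqrt ?_
    calc lo ^ 2 * (((∑ a, k a ^ 2) * ∑ i, p i ^ 2) * ((∑ a, k a ^ 2) * ∑ i, q i ^ 2))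
        = (lo * ((∑ a, k a ^ 2) * ∑ i, p i ^ 2)) * (lo * ((∑ a, k a ^ 2) * ∑ i, q i ^ 2)) := by ring
      _ ≤ Torus.symb X k p * Torus.symb X k q := mul_le_mul hlp hlq (mul_nonneg hlo.le hQq0) hXp0
  have hB : |Torus.bsymb R k p q - Torus.bsymb R k q p| ≤ ε₁ / lo * Real.sqrt (Torus.symb X k p * Torus.symb X k q) := by
    have h1 : Real.sqrt (((∑ a, k a ^ 2) * ∑ i, p i ^ 2) * ((∑ a, k a ^ 2) * ∑ i, q i ^ 2)) ≤
        Real.sqrt (Torus.symb X k p * Torus.symb X k q) / lo := by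
      rw [le_div_iff₀ hlo, mul_comm]; exact hkey
    calc _ ≤ _ := hB0
      _ ≤ ε₁ * (Real.sqrt (Torus.symb X k p * Torus.symb X k q) / lo) := mul_le_mul_of_nonneg_left h1 hε₁
      _ = ε₁ / lo * Real.sqrt (Torus.symb X k p * Torus.symb X k q) := by ring
  -- combine
  rw [Torus.bsymb_add, Torus.bsymb_add]
  have hAB : |Torus.bsymb X k p q + Torus.bsymb R k p q - (Torus.bsymb X k q p + Torus.bsymb R k q p)| ≤
      (t + ε₁ / lo) * Real.sqrt (Torus.symb X k p * Torus.symb X k q) := by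
    have e : Torus.bsymb X k p q + Torus.bsymb R k p q - (Torus.bsymb X k q p + Torus.bsymb R k q p) =
        (Torus.bsymb X k p q - Torus.bsymb X k q p) + (Torus.bsymb R k p q - Torus.bsymb R k q p) := by ring
    rw [e]
    refine (abs_add_le _ _).trans ?_
    calc _ ≤ t * Real.sqrt (Torus.symb X k p * Torus.symb X k q) + ε₁ / lo * Real.sqrt (Torus.symb X k p * Torus.symb X k q) :=
          add_le_add hA hB
      _ = (t + ε₁ / lo) * Real.sqrt (Torus.symb X k p * Torus.symb X k q) := by ring
  have hsq := pow_le_pow_left₀ (abs_nonneg _) hAB 2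
  rw [sq_abs, mul_pow, Real.sq_sqrt (mul_nonneg hXp0 hXq0)] at hsq
  have hc0 : 0 ≤ (t + ε₁ / lo) ^ 2 := sq_nonneg _
  have hXY : Torus.symb X k p * Torus.symb X k q ≤
      (lo / (lo - ε₂) * Torus.symb (X + R) k p) * (lo / (lo - ε₂) * Torus.symb (X + R) k q) :=
    mul_le_mul hYp hYq hXq0 (hXp0.trans hYp)
  calc _ ≤ (t + ε₁ / lo) ^ 2 * (Torus.symb X k p * Torus.symb X k q) := hsq
    _ ≤ (t + ε₁ / lo) ^ 2 * ((lo / (lo - ε₂) * Torus.symb (X + R) k p) * (lo / (lo - ε₂) * Torus.symb (X + R) k q)) :=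
        mul_le_mul_of_nonneg_left hXY hc0
    _ = ((t * lo + ε₁) / (lo - ε₂)) ^ 2 * (Torus.symb (X + R) k p * Torus.symb (X + R) k q) := by
        have hlo0 : lo ≠ 0 := hlo.ne'
        have hd0 : lo - ε₂ ≠ 0 := hd.ne'
        field_simp

/-- **The even companion**: `NearIso X lo hi` and `|symb R k p| ≤ ε₂|k|²|p|²` on transverse pairs give `NearIso (X + R) (lo − ε₂) (hi + ε₂)`.
[folklore] -/
theorem nearIso_add_of_abs_le {X R : T4} {lo hi ε₂ : ℝ} (hXn : Torus.NearIso X lo hi)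
    (hRn : ∀ k p : Fin 3 → ℝ, ∑ i, p i * k i = 0 → |Torus.symb R k p| ≤ ε₂ * ((∑ a, k a ^ 2) * ∑ i, p i ^ 2)) :
    Torus.NearIso (X + R) (lo - ε₂) (hi + ε₂) := by
  intro k p hp
  obtain ⟨hl, hh⟩ := hXn k p hp
  have hR := abs_le.1 (hRn k p hp)
  rw [Torus.symb_add]
  constructor <;> nlinarith [hR.1, hR.2]

end

end Summit.AnomalousDissipation.AnomalousDissipation.Theorems.SolenoidalFractalHomogenisation.LagrangianStep
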